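import Summits.Ventures.GridStability.Bench.GFMSMIBDeg4AQoriaV4phys
import Summits.Ventures.GridStability.Lyapunov.CertificateSoundness
import Summits.Ventures.GridStability.Lyapunov.AngleRecovery
import Summits.Ventures.GridStability.Models.SMIB
import Mathlib.Analysis.Calculus.Deriv.Mul
import Mathlib.Analysis.Calculus.Deriv.Pow
import Mathlib.Analysis.Calculus.Deriv.Prod
import Mathlib.Analysis.Normed.Module.FiniteDimension
import Mathlib.Analysis.SpecialFunctions.Trigonometric.Deriv
import HarnessLib

/-!
# G3.a+ «GFM-SMIB-QoriaV4»-roa, degree 4 — from the kernel-checked certificate (deg 4, toolchain A, physical-time reading)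
# to invariance, no pole slip, and convergence to the synchronous equilibrium FOR THE MODEL M′

Venture GRIDFUSION, `plan/PARTITION.md` A2 (G1-alg / G1-roa), A5″ (bridge), A6 (pole-slip rule),
A19 (rung G3.a); director RULING 12 (higher degree = the «+» improvement row, not a condition of the
close); seat gridfusion-lyap-1 (g2). Companion of `Bench/GFMSMIBDeg4AQoriaV4phys{Data,}.lean`
(sos-5, p470051 / p470060; certificate file `cert/A/GFM-SMIB-deg4-A-QoriaV4phys.json` sha256
`be1bb781f69ae869…`), whose decls it uses VERBATIM (`deg4_A_QoriaV4phys_{f_sigma,f_kappa,f_omega,h,V,Vdot}` via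
their `_eq` lemmas and the four CERTIFIED identities `deg4_A_QoriaV4phys_{V_pos, Vdot_neg, level_in_ball,
arc_excl}`); the analysis is `Lyapunov/{SublevelTrapping, CertificateSoundness, AngleRecovery}.lean`
(p459619 / p460300 / p460639); the original-coordinate model and the exact embedding are model-1's
`Models/SMIB.lean` (p460909). Same shape as the degree-2 companion
`Bench/GFMSMIBDeg2AQoriaV4physRoa.lean` (p470551); the hypothesis-free instance readings (model-1's
`SMIB.gfmQoriaV4Phys`, model-3's droop grid-forming inverter `InverterDroop.gfmSmibQoriaV4`) follow
from `deg4_A_QoriaV4phys_smib_roa` exactly as in `Bench/GFMSMIBDeg2AQoriaV4physRoaModel.lean` (p475563) with the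
same kernel facts (`SMIB.gfmQoriaV4Phys_relations`, `gfmSmibQoriaV4.rel_a / rel_b / rel_d /
power_balance`) and are not repeated here.

THREE COLUMNS. CERTIFIED (kernel, in the Bench file): on `{h = 0}`: `V ≥ (1/100)φ`; on
`{h = 0} ∩ {V ≤ 21/4}`: `V̇ ≤ −(1/2000)φ`, `φ ≤ 3`, `κ ≤ 1`, with `φ = σ² + κ² + ω²/4500` and the
degree-4 `V` of the file. MODELLED: every theorem of THIS file is about an ODE — the recast
polynomial system `ż = F(z)` on `{h = 0} ⊂ ℝ³` (`deg4_A_QoriaV4phys_roa`) and model-1's classical SMIB model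
(`deg4_A_QoriaV4phys_smib_roa`) for ANY parameter record `p : SMIB` and equilibrium angle `δs` satisfying the A1
data relations of the instance (`P_M cos(δs−γ)/M = 233605208200/1873666673`,
`P_M sin(δs−γ)/M = 29431488000/1873666673`, `D/M = 33`, `P_e(δs) = P_m`) — M′ = reduced-order droop
/ VSM converter against an infinite bus ≡ classical SMIB (model-3 `InverterBridgesSMIB` p462458;
MODEL-VALIDITY MV-6D+MV-P+MV-Ω(ω_b′ = 35500/113); inner loops, filter / line / dc-side dynamics,
current limits, voltage dynamics ABSENT). VALIDATED: nothing. No sentence of this file says a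
converter or a grid is stable; «region of attraction» below means: the stated set of initial
conditions OF THE MODEL M′ is carried to the model's synchronous equilibrium.

STATEMENTS. `deg4_A_QoriaV4phys_roa`: for every `0 < γ ≤ 21/4` and every solution `z` of the recast system on
`[0, ∞)` (Mathlib sense: continuous, right derivative `F (z t)`) with `h(z 0) = 0`,
`V(z 0) ≤ γ`: `V(z t) ≤ γ` and `κ(t) ≤ 1` for all `t ≥ 0`, and `z t → 0`.
`deg4_A_QoriaV4phys_smib_roa`: for every solution `(δ, ω)` of the SMIB model `p` on `[0, ∞)` with
`V(sin u₀, 1 − cos u₀, ω₀) ≤ γ`, `|u₀| < π` (`u = δ − δs`): for all `t ≥ 0`, `V ≤ γ` along the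
recast state and `|u t| < π` (no pole slip), and `(δ t, ω t) → (δs, 0)`.
Obligations O1–O10 as in `TOYDeg2handRoa` (template): the domain `D = {φ ≤ 3}` is discharged on
`{h = 0} ∩ {V ≤ 21/4}` by `level_in_ball`, `W = (1/2000)φ` is positive definite, compactness comes
from `level_in_ball` (`‖z‖∞ ≤ 117`), and the arc conjunct `κ ≤ 1` gives `cos u ≥ 0 > −1` for the
angle recovery. Existence of the global solution:
`Literature.Analysis.ODE.exists_global_solution_of_sublevel` (lit-6, p458002) — not restated.
-/


namespace Summit.Ventures.GridStability.Bench.GFMSMIB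

open Set Filter Metric Topology Real
open Summit.Ventures.GridStability.Lyapunov Summit.Ventures.GridStability.Models
open Literature.Computation.Certificates Literature.Computation.Certificates.SOS

noncomputable section

/-! ### Recast phase space `Fin 3 → ℝ`, coordinates in the certificate's variable order ['sigma', 'kappa', 'omega'] -/

/-- The recast field of the instance on `Fin 3 → ℝ` (components = the Bench decls verbatim).
MODELLED column. [folklore] -/
def deg4_A_QoriaV4phys_F (z : Fin 3 → ℝ) : Fin 3 → ℝ :=
  ![deg4_A_QoriaV4phys_f_sigma (z 0) (z 1) (z 2),
    deg4_A_QoriaV4phys_f_kappa (z 0) (z 1) (z 2),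
    deg4_A_QoriaV4phys_f_omega (z 0) (z 1) (z 2)]

/-- The certificate's `V` on the phase space. [folklore] -/
def deg4_A_QoriaV4phys_Vz (z : Fin 3 → ℝ) : ℝ := deg4_A_QoriaV4phys_V (z 0) (z 1) (z 2)

/-- Its Lie derivative `∇V·f` (the emitted `Vdot`). [folklore] -/
def deg4_A_QoriaV4phys_LVz (z : Fin 3 → ℝ) : ℝ := deg4_A_QoriaV4phys_Vdot (z 0) (z 1) (z 2)

/-- The certified dissipation rate `W = ε_dot·φ`. [folklore] -/
def deg4_A_QoriaV4phys_Wz (z : Fin 3 → ℝ) : ℝ := ((1 : ℝ) / 2000) * ((1 : ℝ) * z 0 ^ 2 + (1 : ℝ) * z 1 ^ 2 + ((1 : ℝ) / 4500) * z 2 ^ 2)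

/-- The recast constraint set `M = {h_j = 0}`. [folklore] -/
def deg4_A_QoriaV4phys_M : Set (Fin 3 → ℝ) := {z | deg4_A_QoriaV4phys_h (z 0) (z 1) (z 2) = 0}

/-- The certificate's level `c = 21/4`. [folklore] -/
def deg4_A_QoriaV4phys_level : ℝ := ((21 : ℝ) / 4)

/-- Component `0` (`sigma`) of the recast field. [folklore] -/
@[simp] theorem deg4_A_QoriaV4phys_F_0 (z : Fin 3 → ℝ) : deg4_A_QoriaV4phys_F z 0 = deg4_A_QoriaV4phys_f_sigma (z 0) (z 1) (z 2) := rfl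
/-- Component `1` (`kappa`) of the recast field. [folklore] -/
@[simp] theorem deg4_A_QoriaV4phys_F_1 (z : Fin 3 → ℝ) : deg4_A_QoriaV4phys_F z 1 = deg4_A_QoriaV4phys_f_kappa (z 0) (z 1) (z 2) := rfl
/-- Component `2` (`omega`) of the recast field. [folklore] -/
@[simp] theorem deg4_A_QoriaV4phys_F_2 (z : Fin 3 → ℝ) : deg4_A_QoriaV4phys_F z 2 = deg4_A_QoriaV4phys_f_omega (z 0) (z 1) (z 2) := rfl

/-! ### Algebraic consequences of the certified identities -/

/-- Dissipation inequality in bridge form on `M ∩ {V ≤ c}`: `LV ≤ −W` (domain hypotheses of the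
Bench theorem discharged by `level_in_ball`). CERTIFIED input: `deg4_A_QoriaV4phys_Vdot_neg`. [folklore] -/
theorem deg4_A_QoriaV4phys_LVz_le {z : Fin 3 → ℝ} (hz : z ∈ deg4_A_QoriaV4phys_M) (hV : deg4_A_QoriaV4phys_Vz z ≤ deg4_A_QoriaV4phys_level) :
    deg4_A_QoriaV4phys_LVz z ≤ -deg4_A_QoriaV4phys_Wz z := by
  have h := deg4_A_QoriaV4phys_Vdot_neg (z 0) (z 1) (z 2) hV (by have hb := deg4_A_QoriaV4phys_level_in_ball (z 0) (z 1) (z 2) hV hz; linarith) hz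
  simp only [deg4_A_QoriaV4phys_LVz, deg4_A_QoriaV4phys_Wz]
  linarith

/-- `W = ε·φ` is positive definite: its only zero is the origin. [folklore] -/
theorem deg4_A_QoriaV4phys_eq_zero_of_Wz {z : Fin 3 → ℝ} (hW : deg4_A_QoriaV4phys_Wz z = 0) : z = 0 := by
  simp only [deg4_A_QoriaV4phys_Wz] at hW
  have e0 : z 0 = 0 := by nlinarith [sq_nonneg (z 0), sq_nonneg (z 1), sq_nonneg (z 2)]
  have e1 : z 1 = 0 := by nlinarith [sq_nonneg (z 0), sq_nonneg (z 1), sq_nonneg (z 2)]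
  have e2 : z 2 = 0 := by nlinarith [sq_nonneg (z 0), sq_nonneg (z 1), sq_nonneg (z 2)]
  funext i
  fin_cases i <;> simp [e0, e1, e2]

/-- Strictness on every level surface `{V = γ}`, `γ > 0`: `W > 0` there. [folklore] -/
theorem deg4_A_QoriaV4phys_Wz_pos {z : Fin 3 → ℝ} {γ : ℝ} (hγ0 : 0 < γ) (hV : deg4_A_QoriaV4phys_Vz z = γ) :
    0 < deg4_A_QoriaV4phys_Wz z := by
  have hW0 : 0 ≤ deg4_A_QoriaV4phys_Wz z := by simp only [deg4_A_QoriaV4phys_Wz]; positivity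
  rcases hW0.lt_or_eq with h | h
  · exact h
  · exfalso
    have hz0 := deg4_A_QoriaV4phys_eq_zero_of_Wz h.symm
    subst hz0
    simp [deg4_A_QoriaV4phys_Vz, deg4_A_QoriaV4phys_V_eq] at hV
    linarith

/-- Arc exclusion (A6) on the certified piece: `kappa ≤ 1`. CERTIFIED input: `deg4_A_QoriaV4phys_arc_excl`. [folklore] -/
theorem deg4_A_QoriaV4phys_arc_kappa {z : Fin 3 → ℝ} (hz : z ∈ deg4_A_QoriaV4phys_M) (hV : deg4_A_QoriaV4phys_Vz z ≤ deg4_A_QoriaV4phys_level) :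
    z 1 ≤ (1 : ℝ) := by
  have h := deg4_A_QoriaV4phys_arc_excl (z 0) (z 1) (z 2) hV hz
  linarith

/-- Compactness of the certified piece `S = {z ∈ M | V z ≤ c}` (closed; bounded by
`level_in_ball`: `‖z‖∞ ≤ 117`). [folklore] -/
theorem deg4_A_QoriaV4phys_isCompact_S : IsCompact {z ∈ deg4_A_QoriaV4phys_M | deg4_A_QoriaV4phys_Vz z ≤ deg4_A_QoriaV4phys_level} := by
  have hMc : IsClosed deg4_A_QoriaV4phys_M := by
    simp only [deg4_A_QoriaV4phys_M, deg4_A_QoriaV4phys_h_eq]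
    exact isClosed_eq (by fun_prop) continuous_const
  have hVc : Continuous deg4_A_QoriaV4phys_Vz := by
    unfold deg4_A_QoriaV4phys_Vz; simp only [deg4_A_QoriaV4phys_V_eq]; fun_prop
  have h := isCompact_sublevel_of_norm_le (D := univ) (c := deg4_A_QoriaV4phys_level) (R := (117 : ℝ)) hMc
    isClosed_univ hVc.continuousOn ?_
  · rwa [inter_univ] at h
  rintro z ⟨hz, -⟩ hV
  have hball := deg4_A_QoriaV4phys_level_in_ball (z 0) (z 1) (z 2) hV hz
  have hb0 : |z 0| ≤ (117 : ℝ) :=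
    abs_le.2 (abs_le_of_sq_le_sq' (by nlinarith [sq_nonneg (z 1), sq_nonneg (z 2)]) (by norm_num))
  have hb1 : |z 1| ≤ (117 : ℝ) :=
    abs_le.2 (abs_le_of_sq_le_sq' (by nlinarith [sq_nonneg (z 0), sq_nonneg (z 2)]) (by norm_num))
  have hb2 : |z 2| ≤ (117 : ℝ) :=
    abs_le.2 (abs_le_of_sq_le_sq' (by nlinarith [sq_nonneg (z 0), sq_nonneg (z 1)]) (by norm_num))
  refine (pi_norm_le_iff_of_nonneg (by norm_num)).2 fun i ↦ ?_
  rw [Real.norm_eq_abs]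
  fin_cases i
  · simpa using hb0
  · simpa using hb1
  · simpa using hb2

/-! ### Calculus along a solution of the recast system -/

/-- **Chain rule**: along a curve with right derivative `F (z t)`, `V ∘ z` has derivative
`LV (z t) = Vdot(z t)`. [folklore] -/
theorem deg4_A_QoriaV4phys_hasDerivWithinAt_Vz {z : ℝ → Fin 3 → ℝ} {t : ℝ} {s : Set ℝ}
    (hz : HasDerivWithinAt z (deg4_A_QoriaV4phys_F (z t)) s t) :
    HasDerivWithinAt (deg4_A_QoriaV4phys_Vz ∘ z) (deg4_A_QoriaV4phys_LVz (z t)) s t := by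
  have h0 : HasDerivWithinAt (fun τ ↦ z τ 0) (deg4_A_QoriaV4phys_f_sigma (z t 0) (z t 1) (z t 2)) s t := by
    simpa using (hasDerivWithinAt_pi.1 hz) 0
  have h1 : HasDerivWithinAt (fun τ ↦ z τ 1) (deg4_A_QoriaV4phys_f_kappa (z t 0) (z t 1) (z t 2)) s t := by
    simpa using (hasDerivWithinAt_pi.1 hz) 1
  have h2 : HasDerivWithinAt (fun τ ↦ z τ 2) (deg4_A_QoriaV4phys_f_omega (z t 0) (z t 1) (z t 2)) s t := by
    simpa using (hasDerivWithinAt_pi.1 hz) 2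
  have heq : deg4_A_QoriaV4phys_Vz ∘ z = fun τ ↦
      ((11189 : ℝ) / 50000) * (z τ 1) + ((284143 : ℝ) / 250000) * (z τ 0 ^ 2) +
      ((103727 : ℝ) / 500000) * (z τ 0 * z τ 1) + ((4631 : ℝ) / 200000) * (z τ 0 * z τ 2) +
      ((1487559 : ℝ) / 1000000) * (z τ 1 ^ 2) + ((-59 : ℝ) / 1000000) * (z τ 1 * z τ 2) +
      ((4233 : ℝ) / 1000000) * (z τ 2 ^ 2) + ((96841 : ℝ) / 1000000) * (z τ 0 ^ 3) +
      ((158883 : ℝ) / 100000) * (z τ 0 ^ 2 * z τ 1) + ((7481 : ℝ) / 1000000) * (z τ 0 ^ 2 * z τ 2) +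
      ((127431 : ℝ) / 1000000) * (z τ 0 * z τ 1 ^ 2) + ((14187 : ℝ) / 250000) * (z τ 0 * z τ 1 * z τ 2) +
      ((-117 : ℝ) / 1000000) * (z τ 0 * z τ 2 ^ 2) + ((867291 : ℝ) / 1000000) * (z τ 1 ^ 3) +
      ((-223 : ℝ) / 200000) * (z τ 1 ^ 2 * z τ 2) + ((2297 : ℝ) / 1000000) * (z τ 1 * z τ 2 ^ 2) +
      ((-3 : ℝ) / 1000000) * (z τ 2 ^ 3) + ((21153 : ℝ) / 1000000) * (z τ 0 ^ 4) +
      ((17573 : ℝ) / 1000000) * (z τ 0 ^ 3 * z τ 1) + ((1459 : ℝ) / 40000) * (z τ 0 ^ 3 * z τ 2) +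
      ((15103 : ℝ) / 31250) * (z τ 0 ^ 2 * z τ 1 ^ 2) + ((847 : ℝ) / 125000) * (z τ 0 ^ 2 * z τ 1 * z τ 2) +
      ((107 : ℝ) / 31250) * (z τ 0 ^ 2 * z τ 2 ^ 2) + ((1811 : ℝ) / 62500) * (z τ 0 * z τ 1 ^ 3) +
      ((4379 : ℝ) / 62500) * (z τ 0 * z τ 1 ^ 2 * z τ 2) + ((-13 : ℝ) / 200000) * (z τ 0 * z τ 1 * z τ 2 ^ 2) +
      ((-101 : ℝ) / 1000000) * (z τ 0 * z τ 2 ^ 3) + ((490171 : ℝ) / 1000000) * (z τ 1 ^ 4) +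
      ((973 : ℝ) / 200000) * (z τ 1 ^ 3 * z τ 2) + ((753 : ℝ) / 500000) * (z τ 1 ^ 2 * z τ 2 ^ 2) +
      ((-3 : ℝ) / 500000) * (z τ 1 * z τ 2 ^ 3) + ((29 : ℝ) / 1000000) * (z τ 2 ^ 4) := by
    funext τ; simp only [Function.comp_apply, deg4_A_QoriaV4phys_Vz]; linear_combination deg4_A_QoriaV4phys_V_eq (z τ 0) (z τ 1) (z τ 2)
  rw [heq]
  refine (((((((((((((((((((((((((((((((((h1.const_mul ((11189 : ℝ) / 50000))).fun_add
      ((h0.fun_pow 2).const_mul ((284143 : ℝ) / 250000))).fun_add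
      ((h0.fun_mul h1).const_mul ((103727 : ℝ) / 500000))).fun_add
      ((h0.fun_mul h2).const_mul ((4631 : ℝ) / 200000))).fun_add
      ((h1.fun_pow 2).const_mul ((1487559 : ℝ) / 1000000))).fun_add
      ((h1.fun_mul h2).const_mul ((-59 : ℝ) / 1000000))).fun_add
      ((h2.fun_pow 2).const_mul ((4233 : ℝ) / 1000000))).fun_add
      ((h0.fun_pow 3).const_mul ((96841 : ℝ) / 1000000))).fun_add
      (((h0.fun_pow 2).fun_mul h1).const_mul ((158883 : ℝ) / 100000))).fun_add
      (((h0.fun_pow 2).fun_mul h2).const_mul ((7481 : ℝ) / 1000000))).fun_add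
      ((h0.fun_mul (h1.fun_pow 2)).const_mul ((127431 : ℝ) / 1000000))).fun_add
      (((h0.fun_mul h1).fun_mul h2).const_mul ((14187 : ℝ) / 250000))).fun_add
      ((h0.fun_mul (h2.fun_pow 2)).const_mul ((-117 : ℝ) / 1000000))).fun_add
      ((h1.fun_pow 3).const_mul ((867291 : ℝ) / 1000000))).fun_add
      (((h1.fun_pow 2).fun_mul h2).const_mul ((-223 : ℝ) / 200000))).fun_add
      ((h1.fun_mul (h2.fun_pow 2)).const_mul ((2297 : ℝ) / 1000000))).fun_add
      ((h2.fun_pow 3).const_mul ((-3 : ℝ) / 1000000))).fun_add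
      ((h0.fun_pow 4).const_mul ((21153 : ℝ) / 1000000))).fun_add
      (((h0.fun_pow 3).fun_mul h1).const_mul ((17573 : ℝ) / 1000000))).fun_add
      (((h0.fun_pow 3).fun_mul h2).const_mul ((1459 : ℝ) / 40000))).fun_add
      (((h0.fun_pow 2).fun_mul (h1.fun_pow 2)).const_mul ((15103 : ℝ) / 31250))).fun_add
      ((((h0.fun_pow 2).fun_mul h1).fun_mul h2).const_mul ((847 : ℝ) / 125000))).fun_add
      (((h0.fun_pow 2).fun_mul (h2.fun_pow 2)).const_mul ((107 : ℝ) / 31250))).fun_add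
      ((h0.fun_mul (h1.fun_pow 3)).const_mul ((1811 : ℝ) / 62500))).fun_add
      (((h0.fun_mul (h1.fun_pow 2)).fun_mul h2).const_mul ((4379 : ℝ) / 62500))).fun_add
      (((h0.fun_mul h1).fun_mul (h2.fun_pow 2)).const_mul ((-13 : ℝ) / 200000))).fun_add
      ((h0.fun_mul (h2.fun_pow 3)).const_mul ((-101 : ℝ) / 1000000))).fun_add
      ((h1.fun_pow 4).const_mul ((490171 : ℝ) / 1000000))).fun_add
      (((h1.fun_pow 3).fun_mul h2).const_mul ((973 : ℝ) / 200000))).fun_add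
      (((h1.fun_pow 2).fun_mul (h2.fun_pow 2)).const_mul ((753 : ℝ) / 500000))).fun_add
      ((h1.fun_mul (h2.fun_pow 3)).const_mul ((-3 : ℝ) / 500000))).fun_add
      ((h2.fun_pow 4).const_mul ((29 : ℝ) / 1000000))).congr_deriv ?_
  simp only [deg4_A_QoriaV4phys_LVz, deg4_A_QoriaV4phys_Vdot_eq, deg4_A_QoriaV4phys_f_sigma_eq, deg4_A_QoriaV4phys_f_kappa_eq, deg4_A_QoriaV4phys_f_omega_eq]
  push_cast
  ring

/-- **`deg4_A_QoriaV4phys_h` is a first integral** of the recast field: `deg4_A_QoriaV4phys_h ∘ z` has right derivative `0`.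
[folklore] -/
theorem deg4_A_QoriaV4phys_hasDerivWithinAt_h {z : ℝ → Fin 3 → ℝ} {t : ℝ} {s : Set ℝ}
    (hz : HasDerivWithinAt z (deg4_A_QoriaV4phys_F (z t)) s t) :
    HasDerivWithinAt (fun τ ↦ deg4_A_QoriaV4phys_h (z τ 0) (z τ 1) (z τ 2)) 0 s t := by
  have h0 : HasDerivWithinAt (fun τ ↦ z τ 0) (deg4_A_QoriaV4phys_f_sigma (z t 0) (z t 1) (z t 2)) s t := by
    simpa using (hasDerivWithinAt_pi.1 hz) 0
  have h1 : HasDerivWithinAt (fun τ ↦ z τ 1) (deg4_A_QoriaV4phys_f_kappa (z t 0) (z t 1) (z t 2)) s t := by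
    simpa using (hasDerivWithinAt_pi.1 hz) 1
  have h2 : HasDerivWithinAt (fun τ ↦ z τ 2) (deg4_A_QoriaV4phys_f_omega (z t 0) (z t 1) (z t 2)) s t := by
    simpa using (hasDerivWithinAt_pi.1 hz) 2
  have heq : (fun τ ↦ deg4_A_QoriaV4phys_h (z τ 0) (z τ 1) (z τ 2)) = fun τ ↦
      (-2 : ℝ) * (z τ 1) + (1 : ℝ) * (z τ 0 ^ 2) +
      (1 : ℝ) * (z τ 1 ^ 2) := by
    funext τ; linear_combination deg4_A_QoriaV4phys_h_eq (z τ 0) (z τ 1) (z τ 2)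
  rw [heq]
  refine ((((h1.const_mul (-2 : ℝ))).fun_add
      ((h0.fun_pow 2).const_mul (1 : ℝ))).fun_add
      ((h1.fun_pow 2).const_mul (1 : ℝ))).congr_deriv ?_
  simp only [deg4_A_QoriaV4phys_f_sigma_eq, deg4_A_QoriaV4phys_f_kappa_eq]
  push_cast
  ring

/-- A solution of the recast system starting on `M` stays on `M` (the constraints are first
integrals). [folklore] -/
theorem deg4_A_QoriaV4phys_mem_M {z : ℝ → Fin 3 → ℝ} (hzc : ContinuousOn z (Ici 0))
    (hz : ∀ t, 0 ≤ t → HasDerivWithinAt z (deg4_A_QoriaV4phys_F (z t)) (Ici t) t)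
    (h0 : z 0 ∈ deg4_A_QoriaV4phys_M) : ∀ t, 0 ≤ t → z t ∈ deg4_A_QoriaV4phys_M := by
  intro T hT
  have hc0 : ContinuousOn (fun τ ↦ deg4_A_QoriaV4phys_h (z τ 0) (z τ 1) (z τ 2)) (Icc 0 T) := by
    have hc : Continuous fun y : Fin 3 → ℝ ↦ deg4_A_QoriaV4phys_h (y 0) (y 1) (y 2) := by
      simp only [deg4_A_QoriaV4phys_h_eq]; fun_prop
    exact hc.comp_continuousOn (hzc.mono fun s hs ↦ hs.1)
  have k0 := constant_of_has_deriv_right_zero hc0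
    (fun t ht ↦ deg4_A_QoriaV4phys_hasDerivWithinAt_h (hz t ht.1)) T ⟨hT, le_rfl⟩
  have z0 : deg4_A_QoriaV4phys_h (z 0 0) (z 0 1) (z 0 2) = 0 := h0
  exact by show deg4_A_QoriaV4phys_h (z T 0) (z T 1) (z T 2) = 0; rw [k0, z0]

/-! ### The ROA inclusion for the recast model -/

/-- **G1-roa (recast coordinates).** MODELLED: the recast polynomial system `ż = F(z)` on
`{h = 0}` of the instance (model-1's `polyField`, interface I2; MODEL-VALIDITY row of the Bench
file). CERTIFIED inputs: the kernel-checked identities of the Bench file. STATEMENT: for every level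
`0 < γ ≤ c = 21/4` and every solution `z` on `[0, ∞)` (Mathlib sense: continuous, right derivative
`F (z t)`) with `z 0 ∈ M`, `V(z 0) ≤ γ`: `V(z t) ≤ γ` and the arc bounds for all `t ≥ 0`, and `z t → 0`.
Via `Lyapunov.certificate_invariance_tendsto_univ`. No sentence here says a machine or a grid is
stable. [folklore] -/
theorem deg4_A_QoriaV4phys_roa {γ : ℝ} (hγ0 : 0 < γ) (hγ : γ ≤ deg4_A_QoriaV4phys_level) {z : ℝ → Fin 3 → ℝ}
    (hzc : ContinuousOn z (Ici 0))
    (hz : ∀ t, 0 ≤ t → HasDerivWithinAt z (deg4_A_QoriaV4phys_F (z t)) (Ici t) t)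
    (h0M : z 0 ∈ deg4_A_QoriaV4phys_M) (h0V : deg4_A_QoriaV4phys_Vz (z 0) ≤ γ) :
    (∀ t, 0 ≤ t → deg4_A_QoriaV4phys_Vz (z t) ≤ γ ∧ z t 1 ≤ (1 : ℝ)) ∧ Tendsto z atTop (𝓝 0) := by
  have hF : Continuous deg4_A_QoriaV4phys_F := by
    refine continuous_pi fun i ↦ ?_
    fin_cases i <;> simp [deg4_A_QoriaV4phys_F, deg4_A_QoriaV4phys_f_sigma_eq, deg4_A_QoriaV4phys_f_kappa_eq, deg4_A_QoriaV4phys_f_omega_eq] <;> fun_prop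
  have hV : Continuous deg4_A_QoriaV4phys_Vz := by unfold deg4_A_QoriaV4phys_Vz; simp only [deg4_A_QoriaV4phys_V_eq]; fun_prop
  have hW : Continuous deg4_A_QoriaV4phys_Wz := by unfold deg4_A_QoriaV4phys_Wz; fun_prop
  have h0 : (0 : Fin 3 → ℝ) ∈ deg4_A_QoriaV4phys_M := by simp [deg4_A_QoriaV4phys_M, deg4_A_QoriaV4phys_h_eq]
  have hMc : IsClosed deg4_A_QoriaV4phys_M := by
    simp only [deg4_A_QoriaV4phys_M, deg4_A_QoriaV4phys_h_eq]
    exact isClosed_eq (by fun_prop) continuous_const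
  have hSγ : IsCompact {y ∈ deg4_A_QoriaV4phys_M | deg4_A_QoriaV4phys_Vz y ≤ γ} :=
    deg4_A_QoriaV4phys_isCompact_S.of_isClosed_subset (hMc.inter (isClosed_le hV continuous_const))
      (fun y hy ↦ ⟨hy.1, hy.2.trans hγ⟩)
  have h := certificate_invariance_tendsto_univ (M := deg4_A_QoriaV4phys_M) (LV := deg4_A_QoriaV4phys_LVz) (W := deg4_A_QoriaV4phys_Wz)
    (x₀ := 0) hSγ hF.continuousOn hV.continuousOn hW.continuousOn
    (fun y hy hVy ↦ deg4_A_QoriaV4phys_LVz_le hy (hVy.trans hγ))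
    (fun y _ _ ↦ by simp only [deg4_A_QoriaV4phys_Wz]; positivity)
    (fun y _ hVy ↦ deg4_A_QoriaV4phys_Wz_pos hγ0 hVy)
    h0 (by simp [deg4_A_QoriaV4phys_Vz, deg4_A_QoriaV4phys_V_eq]; exact hγ0.le) (by simp [deg4_A_QoriaV4phys_Wz])
    (fun y _ _ hWy ↦ deg4_A_QoriaV4phys_eq_zero_of_Wz hWy)
    hzc hz (fun t ht ↦ deg4_A_QoriaV4phys_hasDerivWithinAt_Vz (hz t ht)) (deg4_A_QoriaV4phys_mem_M hzc hz h0M) h0V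
  have hM := deg4_A_QoriaV4phys_mem_M hzc hz h0M
  exact ⟨fun t ht ↦ ⟨h.1 t ht, deg4_A_QoriaV4phys_arc_kappa (hM t ht) ((h.1 t ht).trans hγ)⟩, h.2⟩


/-! ### Back to the machine angle: original coordinates `x = (δ, ω)` via model-1's embedding -/

/-- The image of model-1's embedding `SMIB.embed δs` lies on the recast constraint set. [folklore] -/
theorem deg4_A_QoriaV4phys_embed_mem_M (δs : ℝ) (y : ℝ × ℝ) :
    (fun i : Fin 3 ↦ SMIB.embed δs y i) ∈ deg4_A_QoriaV4phys_M := by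
  show deg4_A_QoriaV4phys_h (SMIB.embed δs y ((0 : Fin 3) : ℕ)) (SMIB.embed δs y ((1 : Fin 3) : ℕ))
    (SMIB.embed δs y ((2 : Fin 3) : ℕ)) = 0
  simp only [Fin.val_zero, Fin.val_one, SMIB.embed_zero, SMIB.embed_one, deg4_A_QoriaV4phys_h_eq]
  nlinarith [sin_sq_add_cos_sq (y.1 - δs)]

/-- **Exact embedding (model-1's chain rule, re-read in the Bench vocabulary).** Along a solution
of the SMIB model `p` whose recast data are the certificate's rationals
(`a = 233605208200/1873666673`, `b = 29431488000/1873666673`, `d = 33`, PARTITION A1′) and whose equilibrium angle is `δs`,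
the recast curve `t ↦ (sin u, 1 − cos u, ω)` solves `ż = F(z)` with the Bench field.
[folklore] -/
theorem deg4_A_QoriaV4phys_hasDerivWithinAt_embed (p : SMIB) {δs : ℝ} (hM : p.M ≠ 0)
    (ha : ((233605208200/1873666673 : ℚ) : ℝ) = p.PM * cos (δs - p.γ) / p.M)
    (hb : ((29431488000/1873666673 : ℚ) : ℝ) = p.PM * sin (δs - p.γ) / p.M)
    (hd : ((33 : ℚ) : ℝ) = p.D / p.M) (hP : p.IsEquilibrium δs)
    {x : ℝ → ℝ × ℝ} {s : Set ℝ} (hx : p.IsSolutionOn x s) {t : ℝ} (ht : t ∈ s) :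
    HasDerivWithinAt (fun τ ↦ fun i : Fin 3 ↦ SMIB.embed δs (x τ) i)
      (deg4_A_QoriaV4phys_F (fun i : Fin 3 ↦ SMIB.embed δs (x t) i)) s t := by
  refine hasDerivWithinAt_pi.2 fun i ↦ ?_
  have h := p.hasDerivWithinAt_embed hM ha hb hd hP hx ht i
  refine h.congr_deriv ?_
  fin_cases i <;>
    simp [SMIB.polyField, SMIB.fσ, SMIB.fκ, SMIB.fω, deg4_A_QoriaV4phys_F, deg4_A_QoriaV4phys_f_sigma_eq, deg4_A_QoriaV4phys_f_kappa_eq,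
      deg4_A_QoriaV4phys_f_omega_eq, Poly.eval_cons, Poly.eval_nil, Monomial.eval_eq, Monomial.evalFrom_cons,
      Monomial.evalFrom_nil, SMIB.embed, vars_cons_zero, vars_cons_succ] <;> ring

/-- **G1.SMIB-roa in original coordinates, with angle recovery (A6).** MODELLED: the classical
SMIB model `M_smib` of Anderson–Fouad (2.40)–(2.42) (+ damping, Sauer–Pai (5.157)) as typed by
model-1 (`SMIB.field`, `SMIB.IsSolutionOn`), for ANY parameter record `p` and equilibrium angle
`δs` satisfying the A1′ data relations of the certified instance (`a = P_M c*/M = 233605208200/1873666673`,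
`b = P_M s*/M = 29431488000/1873666673`, `d = D/M = 33`; instance of record SMIB-K13post-D10 = Kundur 1994
Ex. 13 post-fault plant, `P_m′` per A1′, `K_D = 10`, MV-1). CERTIFIED inputs: the four kernel-checked
identities of the Bench file. STATEMENT: for every `0 < γ ≤ 21/4` and every solution
`x = (δ, ω)` on `[0, ∞)` with `V(sin u₀, 1 − cos u₀, ω₀) ≤ γ` and `|u₀| < π` (`u = δ − δs`): for all
`t ≥ 0`, `V ≤ γ` along the recast state and `|u t| < π` (the relative angle never reaches `±π`:
no pole slip), and `(δ t, ω t) → (δs, 0)`. No sentence here says a machine or a grid is stable.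
[folklore] -/
theorem deg4_A_QoriaV4phys_smib_roa (p : SMIB) {δs : ℝ} (hM : p.M ≠ 0)
    (ha : ((233605208200/1873666673 : ℚ) : ℝ) = p.PM * cos (δs - p.γ) / p.M)
    (hb : ((29431488000/1873666673 : ℚ) : ℝ) = p.PM * sin (δs - p.γ) / p.M)
    (hd : ((33 : ℚ) : ℝ) = p.D / p.M) (hP : p.IsEquilibrium δs)
    {γ : ℝ} (hγ0 : 0 < γ) (hγ : γ ≤ deg4_A_QoriaV4phys_level) {x : ℝ → ℝ × ℝ} (hx : p.IsSolutionOn x (Ici 0))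
    (h0V : deg4_A_QoriaV4phys_V (sin ((x 0).1 - δs)) (1 - cos ((x 0).1 - δs)) (x 0).2 ≤ γ)
    (h0win : |(x 0).1 - δs| < π) :
    (∀ t, 0 ≤ t → deg4_A_QoriaV4phys_V (sin ((x t).1 - δs)) (1 - cos ((x t).1 - δs)) (x t).2 ≤ γ ∧
      |(x t).1 - δs| < π) ∧ Tendsto x atTop (𝓝 (δs, 0)) := by
  set z : ℝ → Fin 3 → ℝ := fun τ i ↦ SMIB.embed δs (x τ) i with hzdef
  have hxc : ContinuousOn x (Ici 0) := fun t ht ↦ (hx t ht).continuousWithinAt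
  have hzc : ContinuousOn z (Ici 0) := by
    have hc : Continuous fun y : ℝ × ℝ ↦ fun i : Fin 3 ↦ SMIB.embed δs y i := by
      refine continuous_pi fun i ↦ ?_
      fin_cases i <;> simp [SMIB.embed] <;> fun_prop
    exact hc.comp_continuousOn hxc
  have hz : ∀ t, 0 ≤ t → HasDerivWithinAt z (deg4_A_QoriaV4phys_F (z t)) (Ici t) t := fun t ht ↦
    (deg4_A_QoriaV4phys_hasDerivWithinAt_embed p hM ha hb hd hP hx ht).mono (Ici_subset_Ici.2 ht)
  have h0M : z 0 ∈ deg4_A_QoriaV4phys_M := deg4_A_QoriaV4phys_embed_mem_M δs (x 0)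
  have h0V' : deg4_A_QoriaV4phys_Vz (z 0) ≤ γ := by simpa [hzdef, deg4_A_QoriaV4phys_Vz] using h0V
  obtain ⟨hinv, hlim⟩ := deg4_A_QoriaV4phys_roa hγ0 hγ hzc hz h0M h0V'
  have hV : ∀ t, 0 ≤ t → deg4_A_QoriaV4phys_V (sin ((x t).1 - δs)) (1 - cos ((x t).1 - δs)) (x t).2 ≤ γ :=
    fun t ht ↦ by simpa [hzdef, deg4_A_QoriaV4phys_Vz] using (hinv t ht).1
  -- no pole slip: `κ ≤ 1` on the certified piece gives `cos u ≥ 0 > -1`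
  have hcos : ∀ t, 0 ≤ t → -1 < cos ((x t).1 - δs) := by
    intro t ht
    have hk := (hinv t ht).2
    simp only [hzdef, Fin.val_one, SMIB.embed_one] at hk
    linarith
  have huc : ContinuousOn (fun t ↦ (x t).1 - δs) (Ici 0) :=
    (continuous_fst.comp_continuousOn hxc).sub continuousOn_const
  have hwin := abs_lt_pi_of_neg_one_lt_cos huc h0win hcos
  have hκ : Tendsto (fun t ↦ 1 - cos ((x t).1 - δs)) atTop (𝓝 0) := by
    simpa [hzdef] using tendsto_pi_nhds.1 hlim 1
  have hω : Tendsto (fun t ↦ (x t).2) atTop (𝓝 0) := by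
    simpa [hzdef] using tendsto_pi_nhds.1 hlim 2
  have hu : Tendsto (fun t ↦ (x t).1 - δs) atTop (𝓝 0) :=
    tendsto_zero_of_one_sub_cos_tendsto hwin hκ
  have hδ : Tendsto (fun t ↦ (x t).1) atTop (𝓝 δs) := by
    have h := hu.add_const δs
    simpa using h
  refine ⟨fun t ht ↦ ⟨hV t ht, hwin t ht⟩, ?_⟩
  have h := hδ.prodMk_nhds hω
  simpa using h

end

end Summit.Ventures.GridStability.Bench.GFMSMIB
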